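import Summits.QuantumFields.BalabanUV.Beta.GAN24.TaylorBlockSum

/-!
# `BalabanUV.Beta.GAN24.TaylorSandwich` — binder row G-an2-4 / (CONV-C), S-slot, road «S3-Taylor» (`SKELETON-S3.md` v1.1 §16): generic leaf
# «SANDWICH*» — THE ABSOLUTE BOUND OF A ONE-CHANNEL THIRD-JET UNIT SANDWICH (two outer legs, the block-averaged vertex leg, a finite table of
# bounded column mass) IS A `BiLoc`-SHAPE AT THE VERTEX BLOCK, WITH AN `N`-FREE CONSTANT (row owner b2b-balaban-gan24-p1, gen 4)

NOT IN PRINT; OUR BOOKKEEPING.  HONEST FRAMING (cell contract, verbatim): «discharging `BetaPertH` makes Bałaban's UV stability UNCONDITIONAL —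
a real constructive-QFT result; it is NOT the continuum limit and NOT the Clay problem.»  HONEST DEPENDENCY (verbatim): «continuum YM on T⁴ ⇐
BetaPertH ∧ nine spine estimates (0/9 proved); BetaPertH ⇐ (D1) ∧ (D4) ∧ CAP+tail; G-an2-4 gates asym, D1 and NE2/3/4.»  [folklore] analysis
on `ℤ^{d+1}` over leaf-04's `TaylorBlockSum` BY NAME: cites nothing, mints no `def … : Prop`, defines nothing, uses no object of an1/an2/an3.
Discharges NOTHING of «E3Shape»/«E3SupRate», (hS, hSall); NOT BetaPertH, NOT continuum, NOT Clay.

## Why (context only; asserted nowhere below)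

Every (V-H) and (Λ) row of the S3 SHAPE table (`StencilSlotE3OfPieces.e3Shape_of_pieces`, rows V0∕Vt∕V∕Λ0∕Λt∕Λ) is, by leaf-01's unit splits
(`E3UnitSplitLevels.e3VH_unit_split_of` ∕ `e3FF_unit_split_of`), a prefactor times ONE-CHANNEL SANDWICHES of the literal shape
`Σ'_y Σ_{l′} (Σ'_w Σ_l A l w · Σ_{κ″} (N^{d+1})⁻¹ Σ'_u H κ″ u · T κ″ u w l y l′) · B l′ y` — `A`, `B` the outer legs (`Φ̃`, `G̃`, `H̃` of
`StencilSlotE3PhiLeg` ∕ `FineReadoutDecay`, block-decaying from the read-out blocks `x′`, `z′`), `H` the block-averaged vertex leg (block-decaying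
from the source block `u′`), `T` the raw increment table (finite column support around `y`, bounded column mass — `TaylorMassVH` ∕ `TaylorMassLam`).
This file proves, ONCE, that such a sandwich is absolutely summable in `y` and bounded by
`(d+1)·CA·CB·CH·Mass·e^{κ(R_W∕N + (d+1))}·e^{κ(R_U∕N + (d+1))}·Zl_{d+1}(κ∕2)·e^{−(κ∕2)(|x′−u′|₁ + |z′−u′|₁)}` — the `BiLoc … u′ u′` shape of `LocStencil` with an
`N`-FREE constant — so that a row assembler only has to (i) cite the unit split, (ii) cite the three leg bounds and the mass bound, (iii) multiply the
prefactor.  NO cancellation is used (§12.5 of the skeleton: the (V-H)∕(Λ) rows close by absolute bounds; the Wilson row W needs W3 instead).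

## Contents ([folklore]; `d` the spatial dimension, sites `Fin (d+1) → ℤ`, `N ≥ 1` the blocking, `quo N` the block index)
§1 finite-support reductions of the inner `tsum`s (`tsum_eq_sum`), termwise domination with leg transfer to the block of `y`
   (`TaylorBlockSum.exp_quo_transfer`), the pointwise bound `abs_term_le`.
§2 **`sandwich_summable`** and **`sandwich_bound`** (the two facts a row assembler consumes; the outer `y`-sum by `TaylorBlockSum.abs_tsum_blockAvg_le₃`).
-/

noncomputable section
open Finset
open scoped BigOperators
open Literature.MathematicalPhysics.QuantumFieldTheory Literature.MathematicalPhysics.QuantumFieldTheory.Balaban1983to89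
open Literature.MathematicalPhysics.QuantumFieldTheory.Balaban1983to89.Beta
open B12Sec2to5 (l1 l1_nonneg)
open ExpKernelCalculus (Zl l1_sub_symm l1_sub_triangle)
open LatticeForm (quo)
open Summit.QuantumFields.BalabanUV.Beta.GAN24.TaylorBlockSum (exp_quo_transfer abs_tsum_blockAvg_le₃ summable_blockAvg_of_le₃ nonneg_of_dominated)

namespace Summit.QuantumFields.BalabanUV.Beta.GAN24.TaylorSandwich

variable {d N : ℕ} [NeZero N]

/-! ## §1 Finite-support reductions and the termwise bound -/

section Term

variable {κ CA CB CH Mass RW RU : ℝ} {x' u' z' : Fin (d + 1) → ℤ}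
  {A B H : Fin (d + 1) → (Fin (d + 1) → ℤ) → ℝ}
  {T : Fin (d + 1) → (Fin (d + 1) → ℤ) → (Fin (d + 1) → ℤ) → Fin (d + 1) → (Fin (d + 1) → ℤ) → Fin (d + 1) → ℝ}
  {Sw Su : (Fin (d + 1) → ℤ) → Finset (Fin (d + 1) → ℤ)}

/-- [folklore] The vertex-leg `tsum` over `u` is a finite sum over the column support `Su y`. -/
theorem tsum_u_eq_sum (hTu : ∀ κ'' u w l y l', T κ'' u w l y l' ≠ 0 → u ∈ Su y)
    (κ'' : Fin (d + 1)) (w : Fin (d + 1) → ℤ) (l : Fin (d + 1)) (y : Fin (d + 1) → ℤ) (l' : Fin (d + 1)) :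
    ∑' u, H κ'' u * T κ'' u w l y l' = ∑ u ∈ Su y, H κ'' u * T κ'' u w l y l' :=
  tsum_eq_sum (s := Su y) fun u hu => by
    have h0 : T κ'' u w l y l' = 0 := by
      by_contra h
      exact hu (hTu κ'' u w l y l' h)
    rw [h0, mul_zero]

/-- [folklore] The `w`-leg `tsum` is a finite sum over the column support `Sw y`. -/
theorem tsum_w_eq_sum (hTw : ∀ κ'' u w l y l', T κ'' u w l y l' ≠ 0 → w ∈ Sw y) (c : ℝ)
    (y : Fin (d + 1) → ℤ) (l' : Fin (d + 1)) :
    ∑' w, ∑ l, A l w * ∑ κ'', c * ∑' u, H κ'' u * T κ'' u w l y l' =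
      ∑ w ∈ Sw y, ∑ l, A l w * ∑ κ'', c * ∑' u, H κ'' u * T κ'' u w l y l' :=
  tsum_eq_sum (s := Sw y) fun w hw => by
    refine Finset.sum_eq_zero fun l _ => ?_
    have h0 : ∀ κ'' u, T κ'' u w l y l' = 0 := by
      intro κ'' u
      by_contra h
      exact hw (hTw κ'' u w l y l' h)
    simp only [h0, mul_zero, tsum_zero, Finset.sum_const_zero]

/-- [folklore] **LEG TRANSFER TO THE BLOCK OF `y`**: a leg decaying from `p` in the block index of `w`, with `|w − y|₁ ≤ R`, is at most
`e^{κ(R∕N + (d+1))}` times the same leg at the block of `y`. -/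
theorem exp_transfer {κ R : ℝ} (hκ : 0 ≤ κ) {w y : Fin (d + 1) → ℤ} (hR : l1 (w - y) ≤ R) (p : Fin (d + 1) → ℤ) :
    Real.exp (-κ * l1 (quo N w - p)) ≤ Real.exp (κ * (R / N + (d + 1))) * Real.exp (-κ * l1 (quo N y - p)) := by
  have h := exp_quo_transfer (N := N) (D := d + 1) hκ w y p
  refine h.trans (mul_le_mul_of_nonneg_right ?_ (Real.exp_pos _).le)
  rw [Real.exp_le_exp]
  have hN : (0 : ℝ) < N := by exact_mod_cast Nat.pos_of_ne_zero (NeZero.ne N)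
  have hdiv : l1 (w - y) / N ≤ R / N := div_le_div_of_nonneg_right hR hN.le
  push_cast
  nlinarith

/-- [folklore] **THE TERMWISE BOUND**: for every `y`, the `y`-term of the sandwich is at most
`(N^{d+1})⁻¹ · (d+1)·CA·CB·CH·Mass·K_W·K_U · e^{−κ(|quo N y − x′|₁ + |quo N y − u′|₁ + |quo N y − z′|₁)}`. -/
theorem abs_term_le (hκ : 0 < κ)
    (hA : ∀ l w, |A l w| ≤ CA * Real.exp (-κ * l1 (x' - quo N w)))
    (hB : ∀ l' y, |B l' y| ≤ CB * Real.exp (-κ * l1 (quo N y - z')))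
    (hH : ∀ κ'' u, |H κ'' u| ≤ CH * Real.exp (-κ * l1 (quo N u - u')))
    (hTw : ∀ κ'' u w l y l', T κ'' u w l y l' ≠ 0 → w ∈ Sw y) (hTu : ∀ κ'' u w l y l', T κ'' u w l y l' ≠ 0 → u ∈ Su y)
    (hRw : ∀ y, ∀ w ∈ Sw y, l1 (w - y) ≤ RW) (hRu : ∀ y, ∀ u ∈ Su y, l1 (u - y) ≤ RU)
    (hmass : ∀ y l', ∑ w ∈ Sw y, ∑ l, ∑ κ'', ∑ u ∈ Su y, |T κ'' u w l y l'| ≤ Mass) (y : Fin (d + 1) → ℤ) :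
    |∑ l', (∑' w, ∑ l, A l w * ∑ κ'', ((N : ℝ) ^ (d + 1))⁻¹ * ∑' u, H κ'' u * T κ'' u w l y l') * B l' y| ≤
      ((N : ℝ) ^ (d + 1))⁻¹ * ((d + 1) * (CA * CB * CH * Mass *
        (Real.exp (κ * (RW / N + (d + 1))) * Real.exp (κ * (RU / N + (d + 1)))))) *
        Real.exp (-κ * (l1 (quo N y - x') + l1 (quo N y - u') + l1 (quo N y - z'))) := by
  have hCA : 0 ≤ CA := nonneg_of_dominated (Real.exp_pos _) (hA 0 0)
  have hCB : 0 ≤ CB := nonneg_of_dominated (Real.exp_pos _) (hB 0 0)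
  have hCH : 0 ≤ CH := nonneg_of_dominated (Real.exp_pos _) (hH 0 0)
  set c : ℝ := ((N : ℝ) ^ (d + 1))⁻¹ with hc
  have hc0 : 0 ≤ c := by positivity
  set KW : ℝ := Real.exp (κ * (RW / N + (d + 1))) with hKW
  set KU : ℝ := Real.exp (κ * (RU / N + (d + 1))) with hKU
  set EA : ℝ := Real.exp (-κ * l1 (quo N y - x')) with hEA
  set EH : ℝ := Real.exp (-κ * l1 (quo N y - u')) with hEH
  set EB : ℝ := Real.exp (-κ * l1 (quo N y - z')) with hEB
  have hKW0 : 0 < KW := Real.exp_pos _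
  have hKU0 : 0 < KU := Real.exp_pos _
  have hEA0 : 0 < EA := Real.exp_pos _
  have hEH0 : 0 < EH := Real.exp_pos _
  have hEB0 : 0 < EB := Real.exp_pos _
  -- transferred leg bounds on the supports
  have hA' : ∀ w ∈ Sw y, ∀ l, |A l w| ≤ CA * KW * EA := by
    intro w hw l
    have ht := exp_transfer (N := N) hκ.le (hRw y w hw) x'
    have e1 : l1 (x' - quo N w) = l1 (quo N w - x') := l1_sub_symm _ _
    calc |A l w| ≤ CA * Real.exp (-κ * l1 (x' - quo N w)) := hA l w
      _ = CA * Real.exp (-κ * l1 (quo N w - x')) := by rw [e1]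
      _ ≤ CA * (KW * EA) := mul_le_mul_of_nonneg_left ht hCA
      _ = CA * KW * EA := by ring
  have hH' : ∀ u ∈ Su y, ∀ κ'', |H κ'' u| ≤ CH * KU * EH := by
    intro u hu κ''
    have ht := exp_transfer (N := N) hκ.le (hRu y u hu) u'
    calc |H κ'' u| ≤ CH * Real.exp (-κ * l1 (quo N u - u')) := hH κ'' u
      _ ≤ CH * (KU * EH) := mul_le_mul_of_nonneg_left ht hCH
      _ = CH * KU * EH := by ring
  have hB' : ∀ l', |B l' y| ≤ CB * EB := fun l' => hB l' y
  -- finite-support reductions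
  rw [Finset.sum_congr rfl fun l' _ => by rw [tsum_w_eq_sum hTw]]
  simp_rw [tsum_u_eq_sum hTu]
  -- the inner block-averaged vertex sum
  have hin : ∀ w ∈ Sw y, ∀ l l', |∑ κ'', c * ∑ u ∈ Su y, H κ'' u * T κ'' u w l y l'| ≤
      c * (CH * KU * EH) * ∑ κ'', ∑ u ∈ Su y, |T κ'' u w l y l'| := by
    intro w hw l l'
    calc |∑ κ'', c * ∑ u ∈ Su y, H κ'' u * T κ'' u w l y l'|
        ≤ ∑ κ'', |c * ∑ u ∈ Su y, H κ'' u * T κ'' u w l y l'| := Finset.abs_sum_le_sum_abs _ _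
      _ ≤ ∑ κ'', c * ((CH * KU * EH) * ∑ u ∈ Su y, |T κ'' u w l y l'|) := by
          refine Finset.sum_le_sum fun κ'' _ => ?_
          rw [abs_mul, abs_of_nonneg hc0]
          refine mul_le_mul_of_nonneg_left ?_ hc0
          calc |∑ u ∈ Su y, H κ'' u * T κ'' u w l y l'| ≤ ∑ u ∈ Su y, |H κ'' u * T κ'' u w l y l'| :=
                Finset.abs_sum_le_sum_abs _ _
            _ ≤ ∑ u ∈ Su y, (CH * KU * EH) * |T κ'' u w l y l'| := by
                refine Finset.sum_le_sum fun u hu => ?_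
                rw [abs_mul]
                exact mul_le_mul_of_nonneg_right (hH' u hu κ'') (abs_nonneg _)
            _ = (CH * KU * EH) * ∑ u ∈ Su y, |T κ'' u w l y l'| := by rw [Finset.mul_sum]
      _ = c * (CH * KU * EH) * ∑ κ'', ∑ u ∈ Su y, |T κ'' u w l y l'| := by
          rw [Finset.mul_sum]
          exact Finset.sum_congr rfl fun _ _ => by ring
  -- the middle w-sum
  have hmid : ∀ l', |∑ w ∈ Sw y, ∑ l, A l w * ∑ κ'', c * ∑ u ∈ Su y, H κ'' u * T κ'' u w l y l'| ≤
      (CA * KW * EA) * (c * (CH * KU * EH)) * ∑ w ∈ Sw y, ∑ l, ∑ κ'', ∑ u ∈ Su y, |T κ'' u w l y l'| := by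
    intro l'
    rw [Finset.mul_sum]
    refine (Finset.abs_sum_le_sum_abs _ _).trans (Finset.sum_le_sum fun w hw => ?_)
    rw [Finset.mul_sum]
    refine (Finset.abs_sum_le_sum_abs _ _).trans (Finset.sum_le_sum fun l _ => ?_)
    rw [abs_mul]
    calc |A l w| * |∑ κ'', c * ∑ u ∈ Su y, H κ'' u * T κ'' u w l y l'|
        ≤ (CA * KW * EA) * (c * (CH * KU * EH) * ∑ κ'', ∑ u ∈ Su y, |T κ'' u w l y l'|) :=
          mul_le_mul (hA' w hw l) (hin w hw l l') (abs_nonneg _) (by positivity)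
      _ = (CA * KW * EA) * (c * (CH * KU * EH)) * ∑ κ'', ∑ u ∈ Su y, |T κ'' u w l y l'| := by ring
  -- the outer l'-sum against the B leg
  have hmass' : ∀ l', 0 ≤ ∑ w ∈ Sw y, ∑ l, ∑ κ'', ∑ u ∈ Su y, |T κ'' u w l y l'| := fun l' =>
    Finset.sum_nonneg fun _ _ => Finset.sum_nonneg fun _ _ => Finset.sum_nonneg fun _ _ => Finset.sum_nonneg fun _ _ => abs_nonneg _
  have hMass : 0 ≤ Mass := (hmass' 0).trans (hmass y 0)
  have hexp3 : EA * EH * EB = Real.exp (-κ * (l1 (quo N y - x') + l1 (quo N y - u') + l1 (quo N y - z'))) := by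
    rw [hEA, hEH, hEB, ← Real.exp_add, ← Real.exp_add]
    congr 1
    ring
  calc |∑ l', (∑ w ∈ Sw y, ∑ l, A l w * ∑ κ'', c * ∑ u ∈ Su y, H κ'' u * T κ'' u w l y l') * B l' y|
      ≤ ∑ l', |(∑ w ∈ Sw y, ∑ l, A l w * ∑ κ'', c * ∑ u ∈ Su y, H κ'' u * T κ'' u w l y l') * B l' y| :=
        Finset.abs_sum_le_sum_abs _ _
    _ ≤ ∑ _l' : Fin (d + 1), (CA * KW * EA) * (c * (CH * KU * EH)) * Mass * (CB * EB) := by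
        refine Finset.sum_le_sum fun l' _ => ?_
        rw [abs_mul]
        refine mul_le_mul ((hmid l').trans ?_) (hB' l') (abs_nonneg _) (by positivity)
        exact mul_le_mul_of_nonneg_left (hmass y l') (by positivity)
    _ = ((N : ℝ) ^ (d + 1))⁻¹ * ((d + 1) * (CA * CB * CH * Mass * (KW * KU))) * (EA * EH * EB) := by
        rw [Finset.sum_const, Finset.card_univ, Fintype.card_fin, nsmul_eq_mul]
        push_cast
        ring
    _ = _ := by rw [hexp3]

end Term

/-! ## §2 The sandwich is absolutely summable in `y` and `BiLoc`-bounded at the vertex block -/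

section Main

variable {κ CA CB CH Mass RW RU : ℝ} {x' u' z' : Fin (d + 1) → ℤ}
  {A B H : Fin (d + 1) → (Fin (d + 1) → ℤ) → ℝ}
  {T : Fin (d + 1) → (Fin (d + 1) → ℤ) → (Fin (d + 1) → ℤ) → Fin (d + 1) → (Fin (d + 1) → ℤ) → Fin (d + 1) → ℝ}
  {Sw Su : (Fin (d + 1) → ℤ) → Finset (Fin (d + 1) → ℤ)}

/-- **«SANDWICH*», SUMMABILITY** [folklore]: under the leg, support and column-mass hypotheses the `y`-terms of the one-channel unit sandwich form a
summable family (so two channels may be split by `tsum_add`). -/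
theorem sandwich_summable (hκ : 0 < κ)
    (hA : ∀ l w, |A l w| ≤ CA * Real.exp (-κ * l1 (x' - quo N w)))
    (hB : ∀ l' y, |B l' y| ≤ CB * Real.exp (-κ * l1 (quo N y - z')))
    (hH : ∀ κ'' u, |H κ'' u| ≤ CH * Real.exp (-κ * l1 (quo N u - u')))
    (hTw : ∀ κ'' u w l y l', T κ'' u w l y l' ≠ 0 → w ∈ Sw y) (hTu : ∀ κ'' u w l y l', T κ'' u w l y l' ≠ 0 → u ∈ Su y)
    (hRw : ∀ y, ∀ w ∈ Sw y, l1 (w - y) ≤ RW) (hRu : ∀ y, ∀ u ∈ Su y, l1 (u - y) ≤ RU)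
    (hmass : ∀ y l', ∑ w ∈ Sw y, ∑ l, ∑ κ'', ∑ u ∈ Su y, |T κ'' u w l y l'| ≤ Mass) :
    Summable fun y : Fin (d + 1) → ℤ =>
      ∑ l', (∑' w, ∑ l, A l w * ∑ κ'', ((N : ℝ) ^ (d + 1))⁻¹ * ∑' u, H κ'' u * T κ'' u w l y l') * B l' y := by
  have hN : ((N : ℝ) ^ (d + 1)) ≠ 0 := pow_ne_zero _ (Nat.cast_ne_zero.2 (NeZero.ne N))
  have hdom := fun y => abs_term_le (N := N) hκ hA hB hH hTw hTu hRw hRu hmass y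
  have hs := summable_blockAvg_of_le₃ (N := N) (D := d + 1) hκ (x := x') (r := u') (z := z')
    (F := fun y => (N : ℝ) ^ (d + 1) *
      ∑ l', (∑' w, ∑ l, A l w * ∑ κ'', ((N : ℝ) ^ (d + 1))⁻¹ * ∑' u, H κ'' u * T κ'' u w l y l') * B l' y)
    (C := (d + 1) * (CA * CB * CH * Mass * (Real.exp (κ * (RW / N + (d + 1))) * Real.exp (κ * (RU / N + (d + 1))))))
    (fun y => by
      rw [abs_mul, abs_of_nonneg (by positivity)]
      have h := mul_le_mul_of_nonneg_left (hdom y) (show (0 : ℝ) ≤ (N : ℝ) ^ (d + 1) by positivity)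
      refine h.trans (le_of_eq ?_)
      field_simp)
  refine hs.congr fun y => ?_
  field_simp

/-- **«SANDWICH*», THE BOUND** [folklore]: the one-channel unit sandwich of a finite table of column mass `≤ Mass` supported within fine distance
`R_W` (w-leg) ∕ `R_U` (vertex leg) of the field leg `y`, read against outer legs decaying at rate `κ` on the block scale from the read-out blocks
`x′` (`A`) and `z′` (`B`) and a block-averaged vertex leg decaying from the source block `u′` (`H`), is bounded by
`(d+1)·CA·CB·CH·Mass·e^{κ(R_W∕N+(d+1))}·e^{κ(R_U∕N+(d+1))}·Zl_{d+1}(κ∕2)·e^{−(κ∕2)(|x′−u′|₁+|z′−u′|₁)}` — the `BiLoc`-shape of `LocStencil` at the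
source block, `N`-FREE. -/
theorem sandwich_bound (hκ : 0 < κ)
    (hA : ∀ l w, |A l w| ≤ CA * Real.exp (-κ * l1 (x' - quo N w)))
    (hB : ∀ l' y, |B l' y| ≤ CB * Real.exp (-κ * l1 (quo N y - z')))
    (hH : ∀ κ'' u, |H κ'' u| ≤ CH * Real.exp (-κ * l1 (quo N u - u')))
    (hTw : ∀ κ'' u w l y l', T κ'' u w l y l' ≠ 0 → w ∈ Sw y) (hTu : ∀ κ'' u w l y l', T κ'' u w l y l' ≠ 0 → u ∈ Su y)
    (hRw : ∀ y, ∀ w ∈ Sw y, l1 (w - y) ≤ RW) (hRu : ∀ y, ∀ u ∈ Su y, l1 (u - y) ≤ RU)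
    (hmass : ∀ y l', ∑ w ∈ Sw y, ∑ l, ∑ κ'', ∑ u ∈ Su y, |T κ'' u w l y l'| ≤ Mass) :
    |∑' y : Fin (d + 1) → ℤ,
        ∑ l', (∑' w, ∑ l, A l w * ∑ κ'', ((N : ℝ) ^ (d + 1))⁻¹ * ∑' u, H κ'' u * T κ'' u w l y l') * B l' y| ≤
      (d + 1) * (CA * CB * CH * Mass * (Real.exp (κ * (RW / N + (d + 1))) * Real.exp (κ * (RU / N + (d + 1))))) *
        Zl (d + 1) (κ / 2) * Real.exp (-(κ / 2) * (l1 (x' - u') + l1 (z' - u'))) := by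
  have hN : ((N : ℝ) ^ (d + 1)) ≠ 0 := pow_ne_zero _ (Nat.cast_ne_zero.2 (NeZero.ne N))
  have hdom := fun y => abs_term_le (N := N) hκ hA hB hH hTw hTu hRw hRu hmass y
  have hb := abs_tsum_blockAvg_le₃ (N := N) (D := d + 1) hκ (x := x') (r := u') (z := z')
    (F := fun y => (N : ℝ) ^ (d + 1) *
      ∑ l', (∑' w, ∑ l, A l w * ∑ κ'', ((N : ℝ) ^ (d + 1))⁻¹ * ∑' u, H κ'' u * T κ'' u w l y l') * B l' y)
    (C := (d + 1) * (CA * CB * CH * Mass * (Real.exp (κ * (RW / N + (d + 1))) * Real.exp (κ * (RU / N + (d + 1))))))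
    (fun y => by
      rw [abs_mul, abs_of_nonneg (by positivity)]
      have h := mul_le_mul_of_nonneg_left (hdom y) (show (0 : ℝ) ≤ (N : ℝ) ^ (d + 1) by positivity)
      refine h.trans (le_of_eq ?_)
      field_simp)
  have hcongr : (fun y : Fin (d + 1) → ℤ => ((N : ℝ) ^ (d + 1))⁻¹ * ((N : ℝ) ^ (d + 1) *
      ∑ l', (∑' w, ∑ l, A l w * ∑ κ'', ((N : ℝ) ^ (d + 1))⁻¹ * ∑' u, H κ'' u * T κ'' u w l y l') * B l' y)) =
      fun y => ∑ l', (∑' w, ∑ l, A l w * ∑ κ'', ((N : ℝ) ^ (d + 1))⁻¹ * ∑' u, H κ'' u * T κ'' u w l y l') * B l' y := by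
    funext y
    field_simp
  rw [hcongr] at hb
  exact hb

end Main

end Summit.QuantumFields.BalabanUV.Beta.GAN24.TaylorSandwich
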